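import Mathlib.Algebra.Field.Basic
import Mathlib.Algebra.CharP.Basic
import Mathlib.Data.Finset.Prod
import Mathlib.Data.Fintype.Card
import Mathlib.Analysis.SpecialFunctions.Pow.Real
import HarnessLib

/-!
# Point–line incidences on Cartesian products over arbitrary fields (Stevens–de Zeeuw 2017)

Topic `Literature/Combinatorics/Additive` (finite-field sum–product / incidence geometry).
One NAMED FACT (`def … : Prop`, never asserted):

* `stevensDeZeeuw_thm4` — S. Stevens, F. de Zeeuw, *An improved point-line incidence bound over
  arbitrary fields*, Bull. Lond. Math. Soc. 49 (2017) 842–858, **Theorem 4** (arXiv:1609.06284,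
  p. 4, as printed): "Let `A, B ⊂ 𝔽` be sets with `|A| = a`, `|B| = b`, `a ≤ b` and `ab² ≤ n³`.
  Let `𝓛` be a finite set of lines of size `n`. If `𝔽` has positive characteristic `p`, assume
  `an ≪ p²`. Then `I(A × B, 𝓛) ≪ a^{3/4} b^{1/2} n^{3/4} + n`."  Here `I(𝓟, 𝓛)` is the number of
  incidences (pairs (point, line) with the point on the line). The proof reduces to Rudnev's
  point–plane incidence theorem (hence to Guth–Katz-type polynomial partitioning over arbitrary
  fields) — deliberately NOT reproduced here.

Rendering choices. Lines of the affine plane `𝔽²` are encoded WITHOUT repetition as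
`(𝔽 × 𝔽) ⊕ 𝔽`: `inl (m, c)` is the non-vertical line `y = m x + c`, `inr c` the vertical line
`x = c`; distinct codes are distinct lines, so a `Finset` of codes is a set of lines and `n` is its
cardinality (repeated lines would break the bound). The hypothesis "`an ≪ p²`" is read in the
standard way: for every constant `c₀ > 0` in the hypothesis `a n ≤ c₀ p²` there is a constant in
the conclusion; characteristic `0` carries no such hypothesis (`ringChar F = 0`). Real exponents
are `Real.rpow`.

Consumers: the band route for the XOR-differentials of `x ↦ gˣ mod p` (crux `DlogGraphFlat` of
`Summits/QuantumAdvantage`, stub `stub_dlogSpreadEnergy`: popular differences of a set with small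
product set via incidences on `(S'S') × (S'S')`), and finite-field sum–product estimates in general.
-/

namespace Literature.Combinatorics.Additive

/-- Incidence of a point `(x, y)` of the affine plane with a coded line: `inl (m, c)` is the line
`y = m x + c`, `inr c` the vertical line `x = c`. [cite: StevensDeZeeuw2017, §1 (points and lines)] -/
def LineIncident {F : Type*} [Field F] (q : F × F) (ℓ : (F × F) ⊕ F) : Prop :=
  match ℓ with
  | Sum.inl (m, c) => q.2 = m * q.1 + c
  | Sum.inr c => q.1 = c

/-- Incidence with a coded line is decidable over a field with decidable equality. [folklore] -/
instance {F : Type*} [Field F] [DecidableEq F] (q : F × F) (ℓ : (F × F) ⊕ F) :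
    Decidable (LineIncident q ℓ) := by
  unfold LineIncident
  rcases ℓ with ⟨m, c⟩ | c <;> infer_instance

/-- **Stevens–de Zeeuw, Theorem 4** (point–line incidences on Cartesian products, as printed):
for `A, B ⊂ 𝔽` with `|A| ≤ |B|`, `|A||B|² ≤ n³`, and a set `𝓛` of `n` lines, assuming
`|A|·n ≤ c₀ p²` in positive characteristic `p`, the number of incidences satisfies
`I(A × B, 𝓛) ≤ C (|A|^{3/4} |B|^{1/2} n^{3/4} + n)` with `C` depending only on `c₀`.
[cite: StevensDeZeeuw2017, Theorem 4] -/
def stevensDeZeeuw_thm4 : Prop :=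
  ∀ c₀ : ℝ, 0 < c₀ → ∃ C : ℝ, 0 < C ∧
    ∀ (F : Type) [Field F] [DecidableEq F] (A B : Finset F) (L : Finset ((F × F) ⊕ F)),
      A.card ≤ B.card → (A.card : ℝ) * (B.card : ℝ) ^ 2 ≤ (L.card : ℝ) ^ 3 →
      (ringChar F = 0 ∨ (A.card : ℝ) * (L.card : ℝ) ≤ c₀ * (ringChar F : ℝ) ^ 2) →
      ((((A ×ˢ B) ×ˢ L).filter fun q => LineIncident q.1 q.2).card : ℝ) ≤
        C * ((A.card : ℝ) ^ (3 / 4 : ℝ) * (B.card : ℝ) ^ (1 / 2 : ℝ) * (L.card : ℝ) ^ (3 / 4 : ℝ) +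
          (L.card : ℝ))

end Literature.Combinatorics.Additive
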